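/-
Copyright (c) 2026 The HCML crux team. All rights reserved.
Released under Apache 2.0 license as described in the file LICENSE.
Authors: K2E3-p14 (g5) (explicit-unit `hodgecm-mathlib-K2E3-p14-g5`)
-/
import Mathlib.LinearAlgebra.Matrix.GeneralLinearGroup.Defs
import Mathlib.Topology.Algebra.Valued.ValuationTopology
import Mathlib.Topology.Instances.Matrix
import Mathlib.Topology.Algebra.Group.Basic
import HarnessLib

/-!
# (GL-[M6]-sc, B4-0, file 1 of 2) The scale-invariant «Ad-height» balls of `GL_n(K)` over a valued field

Cell `hodgecm-mathlib`, Track B, line `K2_E3_EllipticInputs`; payer «GL-[M6]-sc» of leaf (11-3-split-sc) (dealer K2E3-plan (g3) D63, line lead K2E3-p23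
(g5), MEMO «M6sc-ROAD v2» §2 brick B4-0, RULINGS #5 (M5-4) ∕ #7 (M7-2)).  Harish-Chandra's truncated orbital integrals `Θₙ(g) = ∫_{Ω n} θ(xgx⁻¹) dx`
[HarishChandra1970, Part VII §2 p. 69, §3 p. 70] run along a compact exhaustion of the group by HEIGHT BALLS; for a group modulo (a cocompact part of) its
centre the right height is that of `Ad(g)`, i.e. the scale-invariant `max_{i,j,k,l} |g_{ij} · (g⁻¹)_{kl}|` (the entries of `Ad(g) = g ⊗ (g⁻¹)ᵀ`) — the «entry
of `y` × entry of `y⁻¹`» currency of ★ GL-P `K2E3GL3ModCentre.exists_bound_of_isCompact_image`.  This file is the pure ALGEBRA of these balls (any field `K`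
with `Valued K ℤᵐ⁰`, any finite index type); the compact exhaustion of `GL₃(F) ⧸ Λ₀·1` built from them is file 2 `K2E3GL3HeightBallExhaustion`.

THE OBJECT (no `def`; the predicate is spelled out in every statement): for `ϖ ∈ K` and `m : ℕ`,
  `𝔅_m(g) :≡ ∀ i j k l, |ϖ^m · g_{ij} · (g⁻¹)_{kl}| ≤ 1`   («`ϖ^m · Ad(g)` is integral»).
* §1 `𝔅_m` is invariant under ALL scalars (`adBall_mul_scalar_iff`, `adBall_scalar_mul_iff`) — so it descends to `GL_n(K) ⧸ Λ·1` for EVERY `Λ ≤ K^×`;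
  symmetric (`adBall_inv`); SUBMULTIPLICATIVE `𝔅_a · 𝔅_b ⊆ 𝔅_{a+b}` (`adBall_mul`, HC's `‖xy‖ ≤ ‖x‖‖y‖`); monotone (`adBall_succ`, `adBall_mono`); contains
  `GL_n(𝒪)` at level `0` (`adBall_zero_of_forall_v_le_one`) hence `GL_n(𝒪)`-BI-INVARIANT (`adBall_mul_left_iff`, `adBall_mul_right_iff`); read on TORI as
  `max_{i,j} |ϖ^m d_i ∕ d_j| ≤ 1` (`adBall_iff_of_coe_eq_diagonal`, constructor-agnostic); exhaustive (`exists_adBall`); NORMALISED by the top entry: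
  `𝔅_m ⊆ ϖ^ℤ · C_m`, `C_m = {g ∈ M_n(𝒪) : ϖ^m g⁻¹ ∈ M_n(𝒪)}` (`exists_zpow_scalar_mul_integral_of_adBall`), so `𝔅_0 = ϖ^ℤ · GL_n(𝒪)`
  (`adBall_zero_iff_exists_zpow_scalar_mul_integral`, HC's «`‖x‖ = 1 ⟺ x ∈ GL(n, 𝒪)`» modulo scalars).
* §2 `𝔅_m` is clopen in `GL_n(K)` (`isOpen_setOf_adBall`, `isClosed_setOf_adBall`).

HONEST LABEL: HC_CM is proved only modulo the 7 printed citations (2 remaining named inputs: hLiu418 = stmt-HodgeConjecture-24832, h413 =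
stmt-HodgeConjecture-24833) until rung 0 closes; pure structure (Harish-Chandra's bookkeeping p. 69), count-neutral (kernel lane
`--supports stmt-HodgeConjecture-24833 --as helper`), THEOREMS ONLY — no `def`, no instance, no notation, no `sorry`.

## References
* [HarishChandra1970] Harish-Chandra (notes by G. van Dijk), *Harmonic Analysis on Reductive p-adic Groups*, LNM 162 (1970), Part VII §2 p. 69 (`‖x‖`, `σ(x)`,
  `C_α`, `‖xy‖ ≤ ‖x‖‖y‖`), §3 p. 70 (`Ω_T`, the passage to `G ⧸ Z`).
* [PlatonovRapinchuk1994] V. Platonov, A. Rapinchuk, *Algebraic Groups and Number Theory* (1994), §3.3 (`GL_n(𝒪_v)` compact open, `K^× = ϖ^ℤ × 𝒪^×`).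
* [Cartier1979] P. Cartier, *Representations of 𝔭-adic groups: a survey*, PSPM 33.1 (1979), §IV.1 (`K = GL_n(𝒪)`, heights).
-/

open Set Function
open scoped MatrixGroups WithZero Topology
open Matrix

set_option linter.dupNamespace false

noncomputable section

namespace Summit.HodgeConjecture.HodgeConjecture.Cruxes.H413.K2E3GLnAdHeightBalls


/-! ## §1 Algebra of the scale-invariant height balls `𝔅_m(g) :≡ ∀ i j k l, |ϖ^m g_{ij} (g⁻¹)_{kl}| ≤ 1` -/

section Algebra

variable {K : Type*} [Field K] [Valued K ℤᵐ⁰] {n : Type*} [Fintype n] [DecidableEq n]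

/-- A uniformizer is non-zero. [cite: PlatonovRapinchuk1994, §3.3] -/
theorem ne_zero_of_v_eq_exp {ϖ : K} (hϖ : Valued.v ϖ = WithZero.exp (-1 : ℤ)) : ϖ ≠ 0 := by
  intro h; rw [h, map_zero] at hϖ; exact WithZero.zero_ne_coe hϖ

/-- A uniformizer is integral: `|ϖ| ≤ 1`. [cite: PlatonovRapinchuk1994, §3.3] -/
theorem v_le_one_of_v_eq_exp {ϖ : K} (hϖ : Valued.v ϖ = WithZero.exp (-1 : ℤ)) : Valued.v ϖ ≤ 1 := by
  rw [hϖ, ← WithZero.exp_zero, WithZero.exp_le_exp]; norm_num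

/-- For every `x` and a uniformizer `ϖ`, `|ϖ^m x| ≤ 1` for all large `m`. [cite: PlatonovRapinchuk1994, §3.3] -/
theorem exists_forall_v_pow_mul_le_one {ϖ : K} (hϖ : Valued.v ϖ = WithZero.exp (-1 : ℤ)) (x : K) :
    ∃ N : ℕ, ∀ m : ℕ, N ≤ m → Valued.v (ϖ ^ m * x) ≤ 1 := by
  by_cases hx : x = 0
  · exact ⟨0, fun m _ => by rw [hx, mul_zero, map_zero]; exact zero_le⟩
  have hx0 : Valued.v x ≠ 0 := (Valuation.ne_zero_iff _).2 hx
  refine ⟨(WithZero.log (Valued.v x)).toNat, fun m hm => ?_⟩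
  have hlog : WithZero.log (Valued.v x) ≤ (m : ℤ) := Int.toNat_le.1 hm
  have hv : Valued.v (ϖ ^ m) = WithZero.exp (-(m : ℤ)) := by rw [map_pow, hϖ, ← WithZero.exp_nsmul, nsmul_eq_mul, mul_neg, mul_one]
  rw [map_mul, hv, ← WithZero.exp_log hx0, ← WithZero.exp_add, ← WithZero.exp_zero, WithZero.exp_le_exp]
  omega

omit [Valued K ℤᵐ⁰] in
/-- Entries of `g · (c·1)`: `(g · c·1)_{ij} = g_{ij} c`. [folklore] -/
theorem coe_mul_scalar_apply (g : GL n K) (c : Kˣ) (i j : n) :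
    ((g * Matrix.GeneralLinearGroup.scalar n c : GL n K) : Matrix n n K) i j = (g : Matrix n n K) i j * (c : K) := by
  rw [Units.val_mul, Matrix.GeneralLinearGroup.coe_scalar, Matrix.scalar_apply, Matrix.mul_diagonal]

omit [Valued K ℤᵐ⁰] in
/-- Entries of `(g · c·1)⁻¹ = c⁻¹ g⁻¹`: `((g · c·1)⁻¹)_{kl} = c⁻¹ (g⁻¹)_{kl}`. [folklore] -/
theorem coe_mul_scalar_inv_apply (g : GL n K) (c : Kˣ) (k l : n) :
    (((g * Matrix.GeneralLinearGroup.scalar n c)⁻¹ : GL n K) : Matrix n n K) k l = ((c : K))⁻¹ * ((g⁻¹ : GL n K) : Matrix n n K) k l := by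
  rw [_root_.mul_inv_rev, ← map_inv, Units.val_mul, Matrix.GeneralLinearGroup.coe_scalar, Matrix.scalar_apply, Matrix.diagonal_mul,
    Units.val_inv_eq_inv_val]

omit [Valued K ℤᵐ⁰] in
/-- Entries of `(c·1) · g`: `(c·1 · g)_{ij} = c g_{ij}`. [folklore] -/
theorem coe_scalar_mul_apply (c : Kˣ) (g : GL n K) (i j : n) :
    ((Matrix.GeneralLinearGroup.scalar n c * g : GL n K) : Matrix n n K) i j = (c : K) * (g : Matrix n n K) i j := by
  rw [Units.val_mul, Matrix.GeneralLinearGroup.coe_scalar, Matrix.scalar_apply, Matrix.diagonal_mul]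

omit [Valued K ℤᵐ⁰] in
/-- Entries of `(c·1 · g)⁻¹ = g⁻¹ c⁻¹`: `((c·1 · g)⁻¹)_{kl} = (g⁻¹)_{kl} c⁻¹`. [folklore] -/
theorem coe_scalar_mul_inv_apply (c : Kˣ) (g : GL n K) (k l : n) :
    (((Matrix.GeneralLinearGroup.scalar n c * g)⁻¹ : GL n K) : Matrix n n K) k l = ((g⁻¹ : GL n K) : Matrix n n K) k l * ((c : K))⁻¹ := by
  rw [_root_.mul_inv_rev, ← map_inv, Units.val_mul, Matrix.GeneralLinearGroup.coe_scalar, Matrix.scalar_apply, Matrix.mul_diagonal,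
    Units.val_inv_eq_inv_val]

omit [Valued K ℤᵐ⁰] in
/-- **SCALE INVARIANCE (right)**: the products `g_{ij} (g⁻¹)_{kl}` — the entries of `Ad(g)` — do not see a scalar factor `c·1`.
[cite: HarishChandra1970, Part VII §3 p. 70] -/
theorem apply_mul_inv_apply_mul_scalar (g : GL n K) (c : Kˣ) (i j k l : n) :
    ((g * Matrix.GeneralLinearGroup.scalar n c : GL n K) : Matrix n n K) i j * (((g * Matrix.GeneralLinearGroup.scalar n c)⁻¹ : GL n K) : Matrix n n K) k l =
      (g : Matrix n n K) i j * ((g⁻¹ : GL n K) : Matrix n n K) k l := by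
  rw [coe_mul_scalar_apply, coe_mul_scalar_inv_apply, mul_assoc, mul_inv_cancel_left₀ c.ne_zero]

omit [Valued K ℤᵐ⁰] in
/-- **SCALE INVARIANCE (left)**: `(c·1 · g)_{ij} ((c·1 · g)⁻¹)_{kl} = g_{ij} (g⁻¹)_{kl}`. [cite: HarishChandra1970, Part VII §3 p. 70] -/
theorem apply_mul_inv_apply_scalar_mul (c : Kˣ) (g : GL n K) (i j k l : n) :
    ((Matrix.GeneralLinearGroup.scalar n c * g : GL n K) : Matrix n n K) i j * (((Matrix.GeneralLinearGroup.scalar n c * g)⁻¹ : GL n K) : Matrix n n K) k l =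
      (g : Matrix n n K) i j * ((g⁻¹ : GL n K) : Matrix n n K) k l := by
  rw [coe_scalar_mul_apply, coe_scalar_mul_inv_apply, mul_comm ((c : K)) _, mul_assoc, ← mul_assoc ((c : K)), mul_comm ((c : K)), mul_assoc,
    mul_inv_cancel₀ c.ne_zero, mul_one]

/-- **`𝔅_m(g · c·1) ↔ 𝔅_m(g)`**: the height balls are invariant under right scalars, hence descend to `GL_n(K) ⧸ Λ·1` for every `Λ ≤ K^×`.
[cite: HarishChandra1970, Part VII §3 p. 70] -/
theorem adBall_mul_scalar_iff (ϖ : K) (m : ℕ) (g : GL n K) (c : Kˣ) :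
    (∀ i j k l, Valued.v (ϖ ^ m * (((g * Matrix.GeneralLinearGroup.scalar n c : GL n K) : Matrix n n K) i j *
        (((g * Matrix.GeneralLinearGroup.scalar n c)⁻¹ : GL n K) : Matrix n n K) k l)) ≤ 1) ↔
      ∀ i j k l, Valued.v (ϖ ^ m * ((g : Matrix n n K) i j * ((g⁻¹ : GL n K) : Matrix n n K) k l)) ≤ 1 := by
  simp only [apply_mul_inv_apply_mul_scalar]

/-- **`𝔅_m(c·1 · g) ↔ 𝔅_m(g)`** (left scalars). [cite: HarishChandra1970, Part VII §3 p. 70] -/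
theorem adBall_scalar_mul_iff (ϖ : K) (m : ℕ) (c : Kˣ) (g : GL n K) :
    (∀ i j k l, Valued.v (ϖ ^ m * (((Matrix.GeneralLinearGroup.scalar n c * g : GL n K) : Matrix n n K) i j *
        (((Matrix.GeneralLinearGroup.scalar n c * g)⁻¹ : GL n K) : Matrix n n K) k l)) ≤ 1) ↔
      ∀ i j k l, Valued.v (ϖ ^ m * ((g : Matrix n n K) i j * ((g⁻¹ : GL n K) : Matrix n n K) k l)) ≤ 1 := by
  simp only [apply_mul_inv_apply_scalar_mul]

/-- **SYMMETRY `𝔅_m⁻¹ = 𝔅_m`**: `𝔅_m(g) → 𝔅_m(g⁻¹)` (the entries of `Ad(g⁻¹)` are those of `Ad(g)` re-indexed). [cite: HarishChandra1970, Part VII §2 p. 69] -/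
theorem adBall_inv {ϖ : K} {m : ℕ} {g : GL n K}
    (h : ∀ i j k l, Valued.v (ϖ ^ m * ((g : Matrix n n K) i j * ((g⁻¹ : GL n K) : Matrix n n K) k l)) ≤ 1) :
    ∀ i j k l, Valued.v (ϖ ^ m * (((g⁻¹ : GL n K) : Matrix n n K) i j * (((g⁻¹)⁻¹ : GL n K) : Matrix n n K) k l)) ≤ 1 := by
  intro i j k l
  rw [inv_inv, mul_comm (((g⁻¹ : GL n K) : Matrix n n K) i j)]
  exact h k l i j

/-- **SUBMULTIPLICATIVITY `𝔅_a · 𝔅_b ⊆ 𝔅_{a+b}`** (Harish-Chandra's `‖xy‖ ≤ ‖x‖‖y‖` for the height of `Ad`): the `(i,j,k,l)` entry of `Ad(gh)` is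
`Σ_{a,b} (g_{ia} (g⁻¹)_{bl}) · (h_{aj} (h⁻¹)_{kb})`, bounded term-wise by the ultrametric inequality. [cite: HarishChandra1970, Part VII §2 p. 69] -/
theorem adBall_mul {ϖ : K} {a b : ℕ} {g h : GL n K}
    (hg : ∀ i j k l, Valued.v (ϖ ^ a * ((g : Matrix n n K) i j * ((g⁻¹ : GL n K) : Matrix n n K) k l)) ≤ 1)
    (hh : ∀ i j k l, Valued.v (ϖ ^ b * ((h : Matrix n n K) i j * ((h⁻¹ : GL n K) : Matrix n n K) k l)) ≤ 1) :
    ∀ i j k l, Valued.v (ϖ ^ (a + b) * (((g * h : GL n K) : Matrix n n K) i j * (((g * h)⁻¹ : GL n K) : Matrix n n K) k l)) ≤ 1 := by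
  intro i j k l
  rw [_root_.mul_inv_rev, Units.val_mul, Units.val_mul, Matrix.mul_apply, Matrix.mul_apply, Finset.sum_mul_sum, Finset.mul_sum]
  refine Valuation.map_sum_le _ fun x _ => ?_
  rw [Finset.mul_sum]
  refine Valuation.map_sum_le _ fun y _ => ?_
  have heq : ϖ ^ (a + b) * ((g : Matrix n n K) i x * (h : Matrix n n K) x j * (((h⁻¹ : GL n K) : Matrix n n K) k y * ((g⁻¹ : GL n K) : Matrix n n K) y l)) =
      (ϖ ^ a * ((g : Matrix n n K) i x * ((g⁻¹ : GL n K) : Matrix n n K) y l)) * (ϖ ^ b * ((h : Matrix n n K) x j * ((h⁻¹ : GL n K) : Matrix n n K) k y)) := by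
    ring
  rw [heq, map_mul]
  exact mul_le_one' (hg i x y l) (hh x j k y)

/-- Monotonicity in the exponent: `𝔅_m ⊆ 𝔅_{m+1}` (`|ϖ| ≤ 1`). [cite: HarishChandra1970, Part VII §2 p. 69] -/
theorem adBall_succ {ϖ : K} (hϖ1 : Valued.v ϖ ≤ 1) {m : ℕ} {g : GL n K}
    (h : ∀ i j k l, Valued.v (ϖ ^ m * ((g : Matrix n n K) i j * ((g⁻¹ : GL n K) : Matrix n n K) k l)) ≤ 1) :
    ∀ i j k l, Valued.v (ϖ ^ (m + 1) * ((g : Matrix n n K) i j * ((g⁻¹ : GL n K) : Matrix n n K) k l)) ≤ 1 := by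
  intro i j k l
  rw [pow_succ', mul_assoc, map_mul]
  exact mul_le_one' hϖ1 (h i j k l)

/-- Monotonicity: `𝔅_m ⊆ 𝔅_{m'}` for `m ≤ m'`. [cite: HarishChandra1970, Part VII §2 p. 69] -/
theorem adBall_mono {ϖ : K} (hϖ1 : Valued.v ϖ ≤ 1) {m m' : ℕ} (hmm' : m ≤ m') {g : GL n K}
    (h : ∀ i j k l, Valued.v (ϖ ^ m * ((g : Matrix n n K) i j * ((g⁻¹ : GL n K) : Matrix n n K) k l)) ≤ 1) :
    ∀ i j k l, Valued.v (ϖ ^ m' * ((g : Matrix n n K) i j * ((g⁻¹ : GL n K) : Matrix n n K) k l)) ≤ 1 := by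
  induction m', hmm' using Nat.le_induction with
  | base => exact h
  | succ m' _ ih => exact adBall_succ hϖ1 ih

/-- **`GL_n(𝒪) ⊆ 𝔅_0`**: an element with integral entries and integral inverse has `Ad`-height `≤ 1`. [cite: HarishChandra1970, Part VII §2 p. 69] -/
theorem adBall_zero_of_forall_v_le_one (ϖ : K) {g : GL n K} (hg : ∀ i j, Valued.v ((g : Matrix n n K) i j) ≤ 1)
    (hg' : ∀ i j, Valued.v (((g⁻¹ : GL n K) : Matrix n n K) i j) ≤ 1) :
    ∀ i j k l, Valued.v (ϖ ^ 0 * ((g : Matrix n n K) i j * ((g⁻¹ : GL n K) : Matrix n n K) k l)) ≤ 1 := by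
  intro i j k l
  rw [pow_zero, one_mul, map_mul]
  exact mul_le_one' (hg i j) (hg' k l)

/-- **LEFT `GL_n(𝒪)`-INVARIANCE**: `𝔅_m(k g) ↔ 𝔅_m(g)` for `k` integral with integral inverse. [cite: HarishChandra1970, Part VII §2 p. 69] -/
theorem adBall_mul_left_iff (ϖ : K) (m : ℕ) {k : GL n K} (hk : ∀ i j, Valued.v ((k : Matrix n n K) i j) ≤ 1)
    (hk' : ∀ i j, Valued.v (((k⁻¹ : GL n K) : Matrix n n K) i j) ≤ 1) (g : GL n K) :
    (∀ i j a b, Valued.v (ϖ ^ m * (((k * g : GL n K) : Matrix n n K) i j * (((k * g)⁻¹ : GL n K) : Matrix n n K) a b)) ≤ 1) ↔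
      ∀ i j a b, Valued.v (ϖ ^ m * ((g : Matrix n n K) i j * ((g⁻¹ : GL n K) : Matrix n n K) a b)) ≤ 1 := by
  have h0 := adBall_zero_of_forall_v_le_one ϖ hk hk'
  have h0' : ∀ i j a b, Valued.v (ϖ ^ 0 * (((k⁻¹ : GL n K) : Matrix n n K) i j * (((k⁻¹)⁻¹ : GL n K) : Matrix n n K) a b)) ≤ 1 := adBall_inv h0
  constructor
  · intro h
    have h1 := adBall_mul h0' h
    simp only [zero_add, inv_mul_cancel_left] at h1
    exact h1
  · intro h
    have h1 := adBall_mul h0 h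
    simp only [zero_add] at h1
    exact h1

/-- **RIGHT `GL_n(𝒪)`-INVARIANCE**: `𝔅_m(g k) ↔ 𝔅_m(g)` for `k` integral with integral inverse. [cite: HarishChandra1970, Part VII §2 p. 69] -/
theorem adBall_mul_right_iff (ϖ : K) (m : ℕ) {k : GL n K} (hk : ∀ i j, Valued.v ((k : Matrix n n K) i j) ≤ 1)
    (hk' : ∀ i j, Valued.v (((k⁻¹ : GL n K) : Matrix n n K) i j) ≤ 1) (g : GL n K) :
    (∀ i j a b, Valued.v (ϖ ^ m * (((g * k : GL n K) : Matrix n n K) i j * (((g * k)⁻¹ : GL n K) : Matrix n n K) a b)) ≤ 1) ↔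
      ∀ i j a b, Valued.v (ϖ ^ m * ((g : Matrix n n K) i j * ((g⁻¹ : GL n K) : Matrix n n K) a b)) ≤ 1 := by
  have h0 := adBall_zero_of_forall_v_le_one ϖ hk hk'
  have h0' : ∀ i j a b, Valued.v (ϖ ^ 0 * (((k⁻¹ : GL n K) : Matrix n n K) i j * (((k⁻¹)⁻¹ : GL n K) : Matrix n n K) a b)) ≤ 1 := adBall_inv h0
  constructor
  · intro h
    have h1 := adBall_mul h h0'
    simp only [add_zero, mul_inv_cancel_right] at h1
    exact h1
  · intro h
    have h1 := adBall_mul h h0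
    simp only [add_zero] at h1
    exact h1

omit [Valued K ℤᵐ⁰] in
/-- The inverse of a diagonal element of `GL_n(K)` is the diagonal of the inverses. [folklore] -/
theorem coe_inv_eq_diagonal_inv {t : GL n K} {d : n → K} (ht : (t : Matrix n n K) = Matrix.diagonal d) :
    ((t⁻¹ : GL n K) : Matrix n n K) = Matrix.diagonal fun i => (d i)⁻¹ := by
  have hd : ∀ i, d i ≠ 0 := by
    intro i hi
    have h1 : ((t * t⁻¹ : GL n K) : Matrix n n K) i i = 1 := by rw [mul_inv_cancel, Units.val_one, Matrix.one_apply_eq]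
    rw [Units.val_mul, ht, Matrix.diagonal_mul, hi, zero_mul] at h1
    exact zero_ne_one h1
  rw [Matrix.coe_units_inv, ht]
  refine Matrix.inv_eq_left_inv ?_
  rw [Matrix.diagonal_mul_diagonal, ← Matrix.diagonal_one]
  congr 1
  funext i
  exact inv_mul_cancel₀ (hd i)

/-- **THE TORUS READING**: for `t = diag(d)`, `𝔅_m(t) ↔ ∀ i j, |ϖ^m d_i ∕ d_j| ≤ 1` — the height of a torus element is `max_{i,j} |d_i∕d_j|`, the
quantity the split-torus ∕ mixed-torus contraction estimates are written in (constructor-agnostic: any `t` whose matrix is `diagonal d`).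
[cite: HarishChandra1970, Part VII §2 p. 69] -/
theorem adBall_iff_of_coe_eq_diagonal (ϖ : K) (m : ℕ) {t : GL n K} {d : n → K} (ht : (t : Matrix n n K) = Matrix.diagonal d) :
    (∀ i j k l, Valued.v (ϖ ^ m * ((t : Matrix n n K) i j * ((t⁻¹ : GL n K) : Matrix n n K) k l)) ≤ 1) ↔
      ∀ i j, Valued.v (ϖ ^ m * (d i * (d j)⁻¹)) ≤ 1 := by
  rw [coe_inv_eq_diagonal_inv ht, ht]
  constructor
  · intro h i j
    have h1 := h i i j j
    rwa [Matrix.diagonal_apply_eq, Matrix.diagonal_apply_eq] at h1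
  · intro h i j k l
    by_cases hij : i = j
    · by_cases hkl : k = l
      · subst hij; subst hkl
        rw [Matrix.diagonal_apply_eq, Matrix.diagonal_apply_eq]
        exact h i k
      · rw [Matrix.diagonal_apply_ne _ hkl, mul_zero, mul_zero, map_zero]; exact zero_le
    · rw [Matrix.diagonal_apply_ne _ hij, zero_mul, mul_zero, map_zero]; exact zero_le

/-- **EXHAUSTION**: every `g` lies in some `𝔅_m`. [cite: HarishChandra1970, Part VII §2 p. 69] -/
theorem exists_adBall {ϖ : K} (hϖ : Valued.v ϖ = WithZero.exp (-1 : ℤ)) (g : GL n K) :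
    ∃ m : ℕ, ∀ i j k l, Valued.v (ϖ ^ m * ((g : Matrix n n K) i j * ((g⁻¹ : GL n K) : Matrix n n K) k l)) ≤ 1 := by
  choose N hN using fun p : (n × n) × (n × n) =>
    exists_forall_v_pow_mul_le_one hϖ ((g : Matrix n n K) p.1.1 p.1.2 * ((g⁻¹ : GL n K) : Matrix n n K) p.2.1 p.2.2)
  exact ⟨Finset.univ.sup N, fun i j k l => hN ((i, j), (k, l)) _ (Finset.le_sup (Finset.mem_univ ((i, j), (k, l))))⟩

omit [Valued K ℤᵐ⁰] in
/-- Some entry of an invertible matrix is non-zero (`n` non-empty). [folklore] -/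
theorem exists_apply_ne_zero [Nonempty n] (g : GL n K) : ∃ p : n × n, (g : Matrix n n K) p.1 p.2 ≠ 0 := by
  obtain ⟨i⟩ := ‹Nonempty n›
  by_cases h : ∀ j, (g : Matrix n n K) i j = 0
  · exfalso
    have h1 : ((g * g⁻¹ : GL n K) : Matrix n n K) i i = 1 := by rw [mul_inv_cancel, Units.val_one, Matrix.one_apply_eq]
    rw [Units.val_mul, Matrix.mul_apply, Finset.sum_eq_zero fun j _ => by rw [h j, zero_mul]] at h1
    exact zero_ne_one h1
  · rw [not_forall] at h
    obtain ⟨j, hj⟩ := h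
    exact ⟨(i, j), hj⟩

/-- **NORMALISATION BY THE TOP ENTRY**: if `𝔅_m(g)` then for `k := log max_{ij} |g_{ij}|` the rescaled `g' = ϖ^k · g` has integral entries and `ϖ^m g'⁻¹` is
integral — `𝔅_m ⊆ ϖ^ℤ · C_m` with `C_m = {g' ∈ M_n(𝒪) : ϖ^m g'⁻¹ ∈ M_n(𝒪)}` (Harish-Chandra: `‖x‖ = 1 ⟺ x ∈ GL(n, 𝒪)`, here modulo scalars).
[cite: HarishChandra1970, Part VII §2 p. 69] [cite: PlatonovRapinchuk1994, §3.3] -/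
theorem exists_zpow_scalar_mul_integral_of_adBall {ϖ : K} (hϖ : Valued.v ϖ = WithZero.exp (-1 : ℤ)) (hϖ0 : ϖ ≠ 0) {m : ℕ} {g : GL n K}
    (h : ∀ i j k l, Valued.v (ϖ ^ m * ((g : Matrix n n K) i j * ((g⁻¹ : GL n K) : Matrix n n K) k l)) ≤ 1) :
    ∃ k : ℤ, (∀ i j, Valued.v (((Matrix.GeneralLinearGroup.scalar n (Units.mk0 ϖ hϖ0 ^ k) * g : GL n K) : Matrix n n K) i j) ≤ 1) ∧
      ∀ i j, Valued.v (ϖ ^ m * (((Matrix.GeneralLinearGroup.scalar n (Units.mk0 ϖ hϖ0 ^ k) * g)⁻¹ : GL n K) : Matrix n n K) i j) ≤ 1 := by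
  rcases isEmpty_or_nonempty n with hn | hn
  · exact ⟨0, fun i => (IsEmpty.false i).elim, fun i => (IsEmpty.false i).elim⟩
  -- the top entry `g_{i₀ j₀}` and its valuation `γ = exp e`
  obtain ⟨p₀, -, hp₀⟩ := Finset.exists_max_image (Finset.univ : Finset (n × n)) (fun p => Valued.v ((g : Matrix n n K) p.1 p.2)) Finset.univ_nonempty
  obtain ⟨p₁, hp₁⟩ := exists_apply_ne_zero g
  have hγ0 : Valued.v ((g : Matrix n n K) p₀.1 p₀.2) ≠ 0 := by
    intro h0
    have h1 := hp₀ p₁ (Finset.mem_univ _)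
    rw [h0, le_zero_iff] at h1
    exact hp₁ ((Valuation.zero_iff _).1 h1)
  set e : ℤ := WithZero.log (Valued.v ((g : Matrix n n K) p₀.1 p₀.2)) with he
  have hγ : Valued.v ((g : Matrix n n K) p₀.1 p₀.2) = WithZero.exp e := (WithZero.exp_log hγ0).symm
  have hc : ((Units.mk0 ϖ hϖ0 ^ e : Kˣ) : K) = ϖ ^ e := by rw [Units.val_zpow_eq_zpow_val, Units.val_mk0]
  have hvc : Valued.v (((Units.mk0 ϖ hϖ0 ^ e : Kˣ) : K)) = WithZero.exp (-e) := by
    rw [hc, map_zpow₀, hϖ, ← WithZero.exp_zsmul, smul_eq_mul, mul_neg, mul_one]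
  have hvc' : Valued.v ((((Units.mk0 ϖ hϖ0 ^ e : Kˣ) : K))⁻¹) = WithZero.exp e := by rw [map_inv₀, hvc, ← WithZero.exp_neg, neg_neg]
  refine ⟨e, fun i j => ?_, fun i j => ?_⟩
  · -- `|ϖ^e g_{ij}| = exp(−e) |g_{ij}| ≤ exp(−e) exp(e) = 1`
    rw [coe_scalar_mul_apply, map_mul, hvc]
    calc WithZero.exp (-e) * Valued.v ((g : Matrix n n K) i j) ≤ WithZero.exp (-e) * WithZero.exp e :=
          mul_le_mul_right ((hp₀ (i, j) (Finset.mem_univ _)).trans_eq hγ) _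
      _ = 1 := by rw [← WithZero.exp_add, neg_add_cancel, WithZero.exp_zero]
  · -- `|ϖ^m (g⁻¹)_{ij} ϖ^{−e}| = |ϖ^m g_{i₀j₀} (g⁻¹)_{ij}| ≤ 1`
    rw [coe_scalar_mul_inv_apply, ← mul_assoc, map_mul, hvc', ← hγ, ← map_mul, mul_assoc, mul_comm (((g⁻¹ : GL n K) : Matrix n n K) i j), ← mul_assoc]
    have h1 := h p₀.1 p₀.2 i j
    rwa [← mul_assoc] at h1

/-- **`𝔅_0 = ϖ^ℤ · GL_n(𝒪)`**: `𝔅_0(g)` iff some rescaling `ϖ^k g` has integral entries and integral inverse. [cite: HarishChandra1970, Part VII §2 p. 69]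
[cite: PlatonovRapinchuk1994, §3.3] -/
theorem adBall_zero_iff_exists_zpow_scalar_mul_integral {ϖ : K} (hϖ : Valued.v ϖ = WithZero.exp (-1 : ℤ)) (hϖ0 : ϖ ≠ 0) (g : GL n K) :
    (∀ i j k l, Valued.v (ϖ ^ 0 * ((g : Matrix n n K) i j * ((g⁻¹ : GL n K) : Matrix n n K) k l)) ≤ 1) ↔
      ∃ k : ℤ, (∀ i j, Valued.v (((Matrix.GeneralLinearGroup.scalar n (Units.mk0 ϖ hϖ0 ^ k) * g : GL n K) : Matrix n n K) i j) ≤ 1) ∧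
        ∀ i j, Valued.v ((((Matrix.GeneralLinearGroup.scalar n (Units.mk0 ϖ hϖ0 ^ k) * g)⁻¹ : GL n K) : Matrix n n K) i j) ≤ 1 := by
  constructor
  · intro h
    obtain ⟨k, hk, hk'⟩ := exists_zpow_scalar_mul_integral_of_adBall hϖ hϖ0 h
    exact ⟨k, hk, fun i j => by simpa only [pow_zero, one_mul] using hk' i j⟩
  · rintro ⟨k, hk, hk'⟩
    exact (adBall_scalar_mul_iff ϖ 0 (Units.mk0 ϖ hϖ0 ^ k) g).1 (adBall_zero_of_forall_v_le_one ϖ hk hk')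

end Algebra

/-! ## §2 Topology: the balls `𝔅_m` are clopen in `GL_n(K)` -/

section Topology

variable {F : Type*} [Field F] [Valued F ℤᵐ⁰] {n : Type*} [Fintype n] [DecidableEq n]

/-- `𝔅_m` is OPEN in `GL_n(F)` (finitely many entry conditions against the open unit ball). [cite: Cartier1979, §IV.1] -/
theorem isOpen_setOf_adBall (ϖ : F) (m : ℕ) :
    IsOpen {g : GL n F | ∀ i j k l, Valued.v (ϖ ^ m * ((g : Matrix n n F) i j * ((g⁻¹ : GL n F) : Matrix n n F) k l)) ≤ 1} := by
  have hO : IsOpen {x : F | Valued.v x ≤ 1} := Valued.isOpen_integer F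
  have hc : ∀ i j k l, Continuous fun g : GL n F => ϖ ^ m * ((g : Matrix n n F) i j * ((g⁻¹ : GL n F) : Matrix n n F) k l) := fun i j k l =>
    continuous_const.mul ((Units.continuous_val.matrix_elem i j).mul (Units.continuous_coe_inv.matrix_elem k l))
  simp only [Set.setOf_forall]
  exact isOpen_iInter_of_finite fun i => isOpen_iInter_of_finite fun j => isOpen_iInter_of_finite fun k => isOpen_iInter_of_finite fun l =>
    hO.preimage (hc i j k l)

/-- `𝔅_m` is CLOSED in `GL_n(F)` (the unit ball is closed). [cite: Cartier1979, §IV.1] -/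
theorem isClosed_setOf_adBall (ϖ : F) (m : ℕ) :
    IsClosed {g : GL n F | ∀ i j k l, Valued.v (ϖ ^ m * ((g : Matrix n n F) i j * ((g⁻¹ : GL n F) : Matrix n n F) k l)) ≤ 1} := by
  have hC : IsClosed {x : F | Valued.v x ≤ 1} := Valued.isClosed_integer F
  have hc : ∀ i j k l, Continuous fun g : GL n F => ϖ ^ m * ((g : Matrix n n F) i j * ((g⁻¹ : GL n F) : Matrix n n F) k l) := fun i j k l =>
    continuous_const.mul ((Units.continuous_val.matrix_elem i j).mul (Units.continuous_coe_inv.matrix_elem k l))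
  simp only [Set.setOf_forall]
  exact isClosed_iInter fun i => isClosed_iInter fun j => isClosed_iInter fun k => isClosed_iInter fun l => hC.preimage (hc i j k l)

end Topology

end Summit.HodgeConjecture.HodgeConjecture.Cruxes.H413.K2E3GLnAdHeightBalls

end
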